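import Summits.AtomisticToContinuum.Crystallization.Theorems.ChartedZeroExcessLayeredLatticeLiouvilleZZZYRCZM

/-!
# Charted zero-excess layered-lattice Liouville — ZZZYRCZO: the LETTER-FUNCTION LAYER (item 5c, r1864 (A)(4)): ideal geometry,
slab box and the comparison lemmas for an ARBITRARY letter sequence `ℓ : ℤ → ℤ`

Cell `decomp-a2c`, lens 2, generation 100.  Ruling r1864 «APERIODIC-COVER»: `UniformEquilStabilityAt` quantifies over every clean
Nash layered chart, and relaxed Barlow stackings with ANY step-sign sequence qualify, so the atlas of line (D) must be indexed by LETTER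
WINDOWS of letter FUNCTIONS, not by a finite list of periodic words.  This file is the generic base of that repair: every object of
ZZZYRCX §1/§4 and the slab box of ZZZYRCZM re-typed over `ℓ : ℤ → ℤ` (letters `ℓ m ∈ {0,1,2}` = `IsLetterSeq ℓ`), with `rfl`-BRIDGES
`…F (regW wd) = …W wd` making the landed periodic files the special case `ℓ := regW wd` (nothing landed is edited), and the two
box lemmas the readers rest on re-proved at this generality from the SAME real cores:

§1 `refF0/refF1/n9F/d18F/sinSq0F/IdealNearF/IdealLengthCmpF/IdealAngleCmpF/IsLetterSeq` + bridges (`rfl`; `IdealNear` via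
   `idealNear_iff`);
§2 `SlabBoxF ℓ aLo aHi s τ hLo hHi L w` (= `SlabBoxW` with `regW wd ↦ ℓ`) + bridge, `bondVec_decomp_of_stepsF`;
§3 ★ `idealLengthCmpF_of_slabBoxF` (the five polynomial checks of ZZZYRCZM, cores `lengthCmp_lower/upper_core` cited, not restated);
§4 ★ `isLayeredCrystal_of_idealLengthCmpF` (per-box co-Lipschitz constant `2c² ≤ λ²`, ZZZYRCZL §1–§2 over `ℓ`),
   `isLayeredCrystal_of_slabBoxF`, `gen_norm_le_of_slabBoxF`;
§5 `ideal_cs` (Cauchy–Schwarz `d18² ≤ 4·n9·n9'` by Lagrange's three-square identity), the swap symmetries of `bondVec` / `sinSqPair` /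
   `d18F` / `sinSq0F`, and `sinSq0F_nonneg`.
The generic ANGLE comparison is the sequel ZZZYRCZP.  The window-keyed reader/kernel contracts (`ThetaReaderNearF`, `KernelSlabSoundF`)
follow census «WINDOW-SPLIT-57» (H₀ of record) and hand-1's windowed kernel RCXR.
-/

namespace Summit.AtomisticToContinuum.Crystallization.Theorems.ChartedZeroExcessLayeredLatticeLiouville

open scoped BigOperators RealInnerProductSpace
open Literature.MathematicalPhysics.StatisticalMechanics (triangularVec₁ triangularVec₂)
open Summit.AtomisticToContinuum.Crystallization.Theorems.ChartedPlanarOrderRigidityDoor (E3)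

/-! ### §1 ideal geometry of a letter sequence and the bridges to the periodic word -/

/-- letters in `{0,1,2}` (A, B, C registries). [g100] -/
def IsLetterSeq (ℓ : ℤ → ℤ) : Prop := ∀ m, 0 ≤ ℓ m ∧ ℓ m ≤ 2

/-- refined in-plane coordinate (thirds of `t₁`): `3γ₀ + ℓ m`. [g100] -/
def refF0 (ℓ : ℤ → ℤ) (s : Cell 2 × ℤ) : ℤ := 3 * s.1 0 + ℓ s.2
/-- refined in-plane coordinate (thirds of `t₂`): `3γ₁ + ℓ m`. [g100] -/
def refF1 (ℓ : ℤ → ℤ) (s : Cell 2 × ℤ) : ℤ := 3 * s.1 1 + ℓ s.2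

/-- `9·|ideal e_x|²` for the pair `x` of a letter sequence. [g100] -/
def n9F (ℓ : ℤ → ℤ) (x : (Cell 2 × ℤ) × (Cell 2 × ℤ)) : ℤ :=
  let a := refF0 ℓ x.2 - refF0 ℓ x.1
  let b := refF1 ℓ x.2 - refF1 ℓ x.1
  a * a + a * b + b * b + 6 * (x.2.2 - x.1.2) ^ 2

/-- `18·⟨ideal e_x, ideal e_q⟩` for two pairs of a letter sequence. [g100] -/
def d18F (ℓ : ℤ → ℤ) (x q : (Cell 2 × ℤ) × (Cell 2 × ℤ)) : ℤ :=
  let a := refF0 ℓ x.2 - refF0 ℓ x.1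
  let b := refF1 ℓ x.2 - refF1 ℓ x.1
  let a' := refF0 ℓ q.2 - refF0 ℓ q.1
  let b' := refF1 ℓ q.2 - refF1 ℓ q.1
  2 * a * a' + 2 * b * b' + a * b' + a' * b + 12 * (x.2.2 - x.1.2) * (q.2.2 - q.1.2)

/-- ideal `sin²` between two pairs of a letter sequence. [g100] -/
noncomputable def sinSq0F (ℓ : ℤ → ℤ) (x q : (Cell 2 × ℤ) × (Cell 2 × ℤ)) : ℝ :=
  1 - (d18F ℓ x q : ℝ) ^ 2 / (4 * n9F ℓ x * n9F ℓ q)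

/-- the ideal near class `n9 ≤ hi` of a letter sequence (no base representative: the sequence need not be periodic). [g100] -/
def IdealNearF (ℓ : ℤ → ℤ) (hi : ℤ) (x : (Cell 2 × ℤ) × (Cell 2 × ℤ)) : Prop := n9F ℓ x ≤ hi

/-- LENGTH comparison `λ²·n9 ≤ 9‖e_x‖² ≤ μ²·n9` for a letter sequence. [g100] -/
def IdealLengthCmpF (ℓ : ℤ → ℤ) (lam mu : ℝ) (a b : E3) (w : ℤ → E3) : Prop :=
  ∀ x : (Cell 2 × ℤ) × (Cell 2 × ℤ),
    lam ^ 2 * (n9F ℓ x : ℝ) ≤ 9 * ‖bondVec a b w x‖ ^ 2 ∧ 9 * ‖bondVec a b w x‖ ^ 2 ≤ mu ^ 2 * (n9F ℓ x : ℝ)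

/-- ANGLE comparison `sin²_actual ≤ K·sin²_ideal + η` for a letter sequence. [g100] -/
def IdealAngleCmpF (ℓ : ℤ → ℤ) (K η : ℝ) (a b : E3) (w : ℤ → E3) : Prop :=
  ∀ x q : (Cell 2 × ℤ) × (Cell 2 × ℤ), 0 < n9F ℓ x → 0 < n9F ℓ q → sinSqPair a b w x q ≤ K * sinSq0F ℓ x q + η

/-- bridge: the periodic word is the letter sequence `regW wd`. [g100] -/
theorem refF0_regW (wd : List ℤ) : refF0 (regW wd) = refW0 wd := rfl
/-- bridge. [g100] -/
theorem refF1_regW (wd : List ℤ) : refF1 (regW wd) = refW1 wd := rfl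
/-- bridge. [g100] -/
theorem n9F_regW (wd : List ℤ) : n9F (regW wd) = n9W wd := rfl
/-- bridge. [g100] -/
theorem d18F_regW (wd : List ℤ) : d18F (regW wd) = d18W wd := rfl
/-- bridge. [g100] -/
theorem sinSq0F_regW (wd : List ℤ) : sinSq0F (regW wd) = sinSq0 wd := rfl
/-- bridge (through `idealNear_iff`: the periodic class is stated on the base representative). [g100] -/
theorem idealNearF_regW_iff (wd : List ℤ) (hi : ℤ) (x : (Cell 2 × ℤ) × (Cell 2 × ℤ)) :
    IdealNearF (regW wd) hi x ↔ IdealNear wd hi x := (idealNear_iff wd hi x).symm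
/-- bridge. [g100] -/
theorem idealLengthCmpF_regW (wd : List ℤ) : IdealLengthCmpF (regW wd) = IdealLengthCmp wd := rfl
/-- bridge. [g100] -/
theorem idealAngleCmpF_regW (wd : List ℤ) : IdealAngleCmpF (regW wd) = IdealAngleCmp wd := rfl
/-- bridge: a word with letters in `{0,1,2}` gives a letter sequence. [g100] -/
theorem isLetterSeq_regW {wd : List ℤ} (h : ∀ c ∈ wd, 0 ≤ c ∧ c ≤ 2) : IsLetterSeq (regW wd) := regW_bounds h

/-- `n9F` is symmetric under swapping the pair. [g100] -/
theorem n9F_swap (ℓ : ℤ → ℤ) (x : (Cell 2 × ℤ) × (Cell 2 × ℤ)) : n9F ℓ (x.2, x.1) = n9F ℓ x := by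
  simp only [n9F]; ring

/-! ### §2 the slab box of a letter sequence and the decomposition of a bond vector -/

/-- ★ THE SLAB BOX of a letter sequence: `SlabBoxW` with `regW wd ↦ ℓ` (chart scale, conformal defect, per-step slip `τ·a` ⊥ n, height
range `[hLo·a, hHi·a]`, the in-plane registry step `((ℓ(m+1) − ℓ m)/3)(g₁ + g₂)`). [g100] -/
def SlabBoxF (ℓ : ℤ → ℤ) (aLo aHi s τ hLo hHi : ℝ) (L : E3 ≃L[ℝ] E3) (w : ℤ → E3) : Prop :=
  ∃ (a : ℝ) (n : E3) (r : ℤ → E3) (h : ℤ → ℝ), aLo ≤ a ∧ a ≤ aHi ∧ IsConfChart a s (L : E3 →L[ℝ] E3) ∧ ‖n‖ = 1 ∧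
    ⟪gen₁ L, n⟫ = 0 ∧ ⟪gen₂ L, n⟫ = 0 ∧ (∀ m, ‖r m‖ ≤ τ * a) ∧ (∀ m, hLo * a ≤ h m ∧ h m ≤ hHi * a) ∧
    (∀ m, ⟪r m, n⟫ = 0) ∧
    ∀ m : ℤ, w (m + 1) - w m = (((ℓ (m + 1) : ℝ) - ℓ m) / 3) • (gen₁ L + gen₂ L) + r m + h m • n

/-- bridge. [g100] -/
theorem slabBoxF_regW (wd : List ℤ) : SlabBoxF (regW wd) = SlabBoxW wd := rfl

/-- DECOMPOSITION of the bond vector of an upward pair (`x.2.2 = x.1.2 + d`) of a letter sequence: chart image of the ideal in-plane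
vector + slip total + height total along the normal (ZZZYRCZM `bondVec_decomp_of_steps` with `regW wd ↦ ℓ`). [g100] -/
theorem bondVec_decomp_of_stepsF {ℓ : ℤ → ℤ} {L : E3 ≃L[ℝ] E3} {w r : ℤ → E3} {h : ℤ → ℝ} {n : E3}
    (hstep : ∀ m : ℤ, w (m + 1) - w m = (((ℓ (m + 1) : ℝ) - ℓ m) / 3) • (gen₁ L + gen₂ L) + r m + h m • n)
    (x : (Cell 2 × ℤ) × (Cell 2 × ℤ)) (d : ℕ) (hd : x.2.2 = x.1.2 + d) :
    bondVec (gen₁ L) (gen₂ L) w x =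
      (L : E3 →L[ℝ] E3) ((((refF0 ℓ x.2 - refF0 ℓ x.1 : ℤ) : ℝ) / 3) • triangularVec₁ 1 +
          (((refF1 ℓ x.2 - refF1 ℓ x.1 : ℤ) : ℝ) / 3) • triangularVec₂ 1) +
        ∑ k ∈ Finset.range d, r (x.1.2 + k) + (∑ k ∈ Finset.range d, h (x.1.2 + k)) • n := by
  have hw := layerSteps_sum w r h (fun m => (ℓ m : ℝ)) (gen₁ L + gen₂ L) n hstep x.1.2 d
  beta_reduce at hw
  rw [← hd] at hw
  have hb : bondVec (gen₁ L) (gen₂ L) w x = ((x.2.1 0 : ℝ) - x.1.1 0) • gen₁ L + ((x.2.1 1 : ℝ) - x.1.1 1) • gen₂ L +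
      (w x.2.2 - w x.1.2) := by
    simp only [bondVec, lsite, sub_smul]; abel
  have hL : (L : E3 →L[ℝ] E3) ((((refF0 ℓ x.2 - refF0 ℓ x.1 : ℤ) : ℝ) / 3) • triangularVec₁ 1 +
      (((refF1 ℓ x.2 - refF1 ℓ x.1 : ℤ) : ℝ) / 3) • triangularVec₂ 1) =
      (((refF0 ℓ x.2 - refF0 ℓ x.1 : ℤ) : ℝ) / 3) • gen₁ L + (((refF1 ℓ x.2 - refF1 ℓ x.1 : ℤ) : ℝ) / 3) • gen₂ L := by
    simp [gen₁, gen₂]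
  have e₀ : ((refF0 ℓ x.2 - refF0 ℓ x.1 : ℤ) : ℝ) / 3 = ((x.2.1 0 : ℝ) - x.1.1 0) + ((ℓ x.2.2 : ℝ) - ℓ x.1.2) / 3 := by
    push_cast [refF0]; ring
  have e₁ : ((refF1 ℓ x.2 - refF1 ℓ x.1 : ℤ) : ℝ) / 3 = ((x.2.1 1 : ℝ) - x.1.1 1) + ((ℓ x.2.2 : ℝ) - ℓ x.1.2) / 3 := by
    push_cast [refF1]; ring
  rw [hb, hw, hL, e₀, e₁, add_smul, add_smul, smul_add]
  abel

/-! ### §3 the length comparison of a letter sequence -/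

/-- both bounds for an UPWARD pair from the box data (ZZZYRCZM `lengthCmp_pair_of_steps` over `ℓ`; the real cores are cited). [g100] -/
theorem lengthCmpF_pair_of_steps {ℓ : ℤ → ℤ} {aLo aHi s τ hLo hHi lam mu a : ℝ} {L : E3 ≃L[ℝ] E3} {w r : ℤ → E3}
    {h : ℤ → ℝ} {n : E3} (haLo : 0 < aLo) (haLo' : aLo ≤ a) (haHi' : a ≤ aHi) (hs0 : 0 ≤ s) (hs1 : s < 1) (hτ : 0 ≤ τ)
    (hhLo : 0 ≤ hLo) (hhHi : 0 ≤ hHi) (hconf : IsConfChart a s (L : E3 →L[ℝ] E3)) (hn : ‖n‖ = 1)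
    (hg₁ : ⟪gen₁ L, n⟫ = 0) (hg₂ : ⟪gen₂ L, n⟫ = 0) (hr : ∀ m, ‖r m‖ ≤ τ * a) (hh : ∀ m, hLo * a ≤ h m ∧ h m ≤ hHi * a)
    (hrn : ∀ m, ⟪r m, n⟫ = 0)
    (hstep : ∀ m : ℤ, w (m + 1) - w m = (((ℓ (m + 1) : ℝ) - ℓ m) / 3) • (gen₁ L + gen₂ L) + r m + h m • n)
    (hA : lam ^ 2 < (1 - s) ^ 2 * aLo ^ 2)
    (hAC : (1 - s) ^ 2 * τ ^ 2 * aLo ^ 4 ≤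
      ((1 - s) ^ 2 * aLo ^ 2 - lam ^ 2) * ((τ ^ 2 + hLo ^ 2) * aLo ^ 2 - 2 / 3 * lam ^ 2))
    (hC2 : lam ^ 2 * (τ ^ 2 + 2 / 3 * (1 - s) ^ 2) ≤ hLo ^ 2 * (1 - s) ^ 2 * aLo ^ 2)
    (hA' : (1 + s) ^ 2 * aHi ^ 2 < mu ^ 2)
    (hAC' : (1 + s) ^ 2 * τ ^ 2 * aHi ^ 4 ≤
      (mu ^ 2 - (1 + s) ^ 2 * aHi ^ 2) * (2 / 3 * mu ^ 2 - (τ ^ 2 + hHi ^ 2) * aHi ^ 2))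
    (x : (Cell 2 × ℤ) × (Cell 2 × ℤ)) (hle : x.1.2 ≤ x.2.2) :
    lam ^ 2 * (n9F ℓ x : ℝ) ≤ 9 * ‖bondVec (gen₁ L) (gen₂ L) w x‖ ^ 2 ∧
      9 * ‖bondVec (gen₁ L) (gen₂ L) w x‖ ^ 2 ≤ mu ^ 2 * (n9F ℓ x : ℝ) := by
  have ha : 0 ≤ a := haLo.le.trans haLo'
  obtain ⟨d, hdℤ⟩ : ∃ d : ℕ, ((d : ℕ) : ℤ) = x.2.2 - x.1.2 := ⟨_, Int.toNat_of_nonneg (sub_nonneg.2 hle)⟩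
  have hd : x.2.2 = x.1.2 + d := by rw [hdℤ]; ring
  have hdℝ : ((d : ℕ) : ℝ) = (x.2.2 : ℝ) - x.1.2 := by exact_mod_cast hdℤ
  obtain ⟨hRle, hHlo, hHhi⟩ := layerSteps_bounds hr hh x.1.2 d
  set c₀ : ℝ := ((refF0 ℓ x.2 - refF0 ℓ x.1 : ℤ) : ℝ) / 3 with hc₀
  set c₁ : ℝ := ((refF1 ℓ x.2 - refF1 ℓ x.1 : ℤ) : ℝ) / 3 with hc₁
  set v : E3 := c₀ • triangularVec₁ 1 + c₁ • triangularVec₂ 1 with hv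
  set R : E3 := ∑ k ∈ Finset.range d, r (x.1.2 + k) with hR
  set H : ℝ := ∑ k ∈ Finset.range d, h (x.1.2 + k) with hH
  have hdec : bondVec (gen₁ L) (gen₂ L) w x = (L : E3 →L[ℝ] E3) v + R + H • n := bondVec_decomp_of_stepsF hstep x d hd
  have hLv : (L : E3 →L[ℝ] E3) v = c₀ • gen₁ L + c₁ • gen₂ L := by simp [hv, gen₁, gen₂]
  have horth : ⟪(L : E3 →L[ℝ] E3) v + R, n⟫ = 0 := by
    rw [inner_add_left, hLv, inner_add_left, real_inner_smul_left, real_inner_smul_left, hg₁, hg₂, hR, sum_inner]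
    simp [hrn]
  have hsq : ‖bondVec (gen₁ L) (gen₂ L) w x‖ ^ 2 = ‖(L : E3 →L[ℝ] E3) v + R‖ ^ 2 + H ^ 2 := by
    rw [hdec]; exact normSq_add_smul_of_inner_zero _ _ _ hn horth
  have hX2 : ‖v‖ ^ 2 = c₀ ^ 2 + c₀ * c₁ + c₁ ^ 2 := by rw [hv]; exact normSq_triangular_comb c₀ c₁
  have hn9 : (n9F ℓ x : ℝ) = 9 * ‖v‖ ^ 2 + 6 * (d : ℝ) ^ 2 := by
    rw [hX2, hc₀, hc₁, hdℝ]; simp only [n9F]; push_cast; ring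
  have hLvb := norm_map_bounds_of_isConfChart ha hconf v
  have hU_lo : (a - s * a) * ‖v‖ - τ * a * d ≤ ‖(L : E3 →L[ℝ] E3) v + R‖ := by
    have h1 : ‖((L : E3 →L[ℝ] E3) v + R) - R‖ ≤ ‖(L : E3 →L[ℝ] E3) v + R‖ + ‖R‖ := norm_sub_le _ _
    rw [add_sub_cancel_right] at h1
    linarith [hLvb.1]
  have hU_hi : ‖(L : E3 →L[ℝ] E3) v + R‖ ≤ (a + s * a) * ‖v‖ + τ * a * d := by
    have h1 := norm_add_le ((L : E3 →L[ℝ] E3) v) R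
    linarith [hLvb.2]
  have hH_lo : hLo * a * d ≤ H := by linarith
  have hH_hi : H ≤ hHi * a * d := by linarith
  have hH0 : 0 ≤ H := le_trans (by positivity) hH_lo
  have hlow := lengthCmp_lower_core (X := ‖v‖) (Y := (d : ℝ)) haLo haLo' hs1 hhLo (norm_nonneg _) (by positivity)
    (norm_nonneg _) hU_lo hH_lo hA hAC hC2
  have hupp := lengthCmp_upper_core (X := ‖v‖) (Y := (d : ℝ)) haHi' hs0 hτ hhHi (norm_nonneg _) (by positivity)
    (norm_nonneg _) hU_hi hH0 hH_hi hA' hAC'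
  rw [hn9, hsq]
  constructor
  · linear_combination (9 : ℝ) * hlow
  · linear_combination (9 : ℝ) * hupp

/-- ★ THE LENGTH COMPARISON of a letter sequence in the slab box, for every `(λ, μ)` passing the five polynomial checks of ZZZYRCZM. [g100] -/
theorem idealLengthCmpF_of_slabBoxF {ℓ : ℤ → ℤ} {aLo aHi s τ hLo hHi lam mu : ℝ} {L : E3 ≃L[ℝ] E3} {w : ℤ → E3}
    (hB : SlabBoxF ℓ aLo aHi s τ hLo hHi L w) (haLo : 0 < aLo) (hs0 : 0 ≤ s) (hs1 : s < 1) (hτ : 0 ≤ τ)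
    (hhLo : 0 ≤ hLo) (hhHi : 0 ≤ hHi)
    (hA : lam ^ 2 < (1 - s) ^ 2 * aLo ^ 2)
    (hAC : (1 - s) ^ 2 * τ ^ 2 * aLo ^ 4 ≤
      ((1 - s) ^ 2 * aLo ^ 2 - lam ^ 2) * ((τ ^ 2 + hLo ^ 2) * aLo ^ 2 - 2 / 3 * lam ^ 2))
    (hC2 : lam ^ 2 * (τ ^ 2 + 2 / 3 * (1 - s) ^ 2) ≤ hLo ^ 2 * (1 - s) ^ 2 * aLo ^ 2)
    (hA' : (1 + s) ^ 2 * aHi ^ 2 < mu ^ 2)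
    (hAC' : (1 + s) ^ 2 * τ ^ 2 * aHi ^ 4 ≤
      (mu ^ 2 - (1 + s) ^ 2 * aHi ^ 2) * (2 / 3 * mu ^ 2 - (τ ^ 2 + hHi ^ 2) * aHi ^ 2)) :
    IdealLengthCmpF ℓ lam mu (gen₁ L) (gen₂ L) w := by
  obtain ⟨a, n, r, h, haLo', haHi', hconf, hn, hg₁, hg₂, hr, hh, hrn, hstep⟩ := hB
  intro x
  rcases le_or_gt x.1.2 x.2.2 with hle | hgt
  · exact lengthCmpF_pair_of_steps haLo haLo' haHi' hs0 hs1 hτ hhLo hhHi hconf hn hg₁ hg₂ hr hh hrn hstep hA hAC hC2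
      hA' hAC' x hle
  · have h' := lengthCmpF_pair_of_steps haLo haLo' haHi' hs0 hs1 hτ hhLo hhHi hconf hn hg₁ hg₂ hr hh hrn hstep hA hAC
      hC2 hA' hAC' (x.2, x.1) hgt.le
    rw [n9F_swap, norm_bondVec_swap] at h'
    exact h'

/-! ### §4 the per-box co-Lipschitz constant and the reader side conditions of a letter sequence -/

/-- letters in `{0,1,2}` ⇒ `(ℓ m' − ℓ m)² ≤ 4·(m' − m)²`. [g100] -/
theorem letterDiff_sq_leF {ℓ : ℤ → ℤ} (h : IsLetterSeq ℓ) (m m' : ℤ) : (ℓ m' - ℓ m) ^ 2 ≤ 4 * (m' - m) ^ 2 := by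
  rcases eq_or_ne m' m with hmm | hmm
  · subst hmm; simp
  · obtain ⟨h0, h2⟩ := h m
    obtain ⟨h0', h2'⟩ := h m'
    have hsq : 1 ≤ (m' - m) ^ 2 := by
      rcases lt_or_gt_of_ne (sub_ne_zero.mpr hmm) with hlt | hgt
      · nlinarith
      · nlinarith
    nlinarith

/-- ★ `9·Δ² ≤ 2·n9F` for each index component of a pair of a letter sequence (constant `1/√2`, sharp). [g100] -/
theorem nine_sq_le_two_n9F {ℓ : ℤ → ℤ} (h : IsLetterSeq ℓ) (x : (Cell 2 × ℤ) × (Cell 2 × ℤ)) :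
    9 * (x.2.1 0 - x.1.1 0) ^ 2 ≤ 2 * n9F ℓ x ∧ 9 * (x.2.1 1 - x.1.1 1) ^ 2 ≤ 2 * n9F ℓ x ∧
      9 * (x.2.2 - x.1.2) ^ 2 ≤ 2 * n9F ℓ x := by
  have hδ := letterDiff_sq_leF h x.1.2 x.2.2
  have e0 : refF0 ℓ x.2 - refF0 ℓ x.1 = 3 * (x.2.1 0 - x.1.1 0) + (ℓ x.2.2 - ℓ x.1.2) := by unfold refF0; ring
  have e1 : refF1 ℓ x.2 - refF1 ℓ x.1 = 3 * (x.2.1 1 - x.1.1 1) + (ℓ x.2.2 - ℓ x.1.2) := by unfold refF1; ring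
  have hn : n9F ℓ x = (refF0 ℓ x.2 - refF0 ℓ x.1) * (refF0 ℓ x.2 - refF0 ℓ x.1) +
      (refF0 ℓ x.2 - refF0 ℓ x.1) * (refF1 ℓ x.2 - refF1 ℓ x.1) + (refF1 ℓ x.2 - refF1 ℓ x.1) * (refF1 ℓ x.2 - refF1 ℓ x.1) +
      6 * (x.2.2 - x.1.2) ^ 2 := rfl
  refine ⟨?_, ?_, ?_⟩
  · rw [hn, e0, e1]; exact nine_sq_le_two_qhex _ _ _ _ hδ
  · have := nine_sq_le_two_qhex (x.2.1 1 - x.1.1 1) (x.2.1 0 - x.1.1 0) (ℓ x.2.2 - ℓ x.1.2) (x.2.2 - x.1.2) hδ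
    rw [hn, e0, e1]; nlinarith [this]
  · rw [hn, e0, e1]
    nlinarith [sq_nonneg (3 * (x.2.1 0 - x.1.1 0) + (ℓ x.2.2 - ℓ x.1.2) + (3 * (x.2.1 1 - x.1.1 1) + (ℓ x.2.2 - ℓ x.1.2))),
      sq_nonneg (3 * (x.2.1 0 - x.1.1 0) + (ℓ x.2.2 - ℓ x.1.2)), sq_nonneg (3 * (x.2.1 1 - x.1.1 1) + (ℓ x.2.2 - ℓ x.1.2))]

/-- one index component: `c²·Δ² ≤ ‖e‖²` from the length comparison. [g100] -/
theorem sq_idx_le_normSqF {ℓ : ℤ → ℤ} {lam mu c : ℝ} {a b : E3} {w : ℤ → E3} (hc2 : 2 * c ^ 2 ≤ lam ^ 2)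
    (hL : IdealLengthCmpF ℓ lam mu a b w) (x : (Cell 2 × ℤ) × (Cell 2 × ℤ)) {Δ : ℤ} (hΔ : 9 * Δ ^ 2 ≤ 2 * n9F ℓ x) :
    c ^ 2 * (Δ : ℝ) ^ 2 ≤ ‖bondVec a b w x‖ ^ 2 := by
  have h1 := (hL x).1
  have hΔ' : 9 * (Δ : ℝ) ^ 2 ≤ 2 * (n9F ℓ x : ℝ) := by exact_mod_cast hΔ
  nlinarith [sq_nonneg (Δ : ℝ), sq_nonneg c]

/-- ★★ THE BOX'S OWN CO-LIPSCHITZ CONSTANT for a letter sequence: `IdealLengthCmpF ℓ λ μ` ⇒ `IsLayeredCrystal c` for every `0 ≤ c`,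
`2c² ≤ λ²` (ZZZYRCZL `isLayeredCrystal_of_idealLengthCmp` over `ℓ`). [g100] -/
theorem isLayeredCrystal_of_idealLengthCmpF {ℓ : ℤ → ℤ} {lam mu c : ℝ} {a b : E3} {w : ℤ → E3} (h012 : IsLetterSeq ℓ)
    (hc : 0 ≤ c) (hc2 : 2 * c ^ 2 ≤ lam ^ 2) (hL : IdealLengthCmpF ℓ lam mu a b w) : IsLayeredCrystal c a b w := by
  intro p q
  rcases hc.eq_or_lt with hc0 | hcp
  · rw [← hc0, zero_mul]; exact norm_nonneg _
  have hb : bondVec a b w (q, p) = lsite a b w p.1 p.2 - lsite a b w q.1 q.2 := rfl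
  obtain ⟨h0, h1, h2⟩ := nine_sq_le_two_n9F h012 (q, p)
  have g0 := abs_idx_le_norm_div hcp (sq_idx_le_normSqF hc2 hL (q, p) h0)
  have g1 := abs_idx_le_norm_div hcp (sq_idx_le_normSqF hc2 hL (q, p) h1)
  have g2 := abs_idx_le_norm_div hcp (sq_idx_le_normSqF hc2 hL (q, p) h2)
  rw [hb] at g0 g1 g2
  simp only [Int.cast_sub] at g0 g1 g2
  have hr : 0 ≤ ‖lsite a b w p.1 p.2 - lsite a b w q.1 q.2‖ / c := by positivity
  rw [← le_div_iff₀' hcp, Prod.dist_eq]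
  refine max_le ((dist_pi_le_iff hr).2 fun i => ?_) ?_
  · fin_cases i
    · simpa [Int.dist_eq] using g0
    · simpa [Int.dist_eq] using g1
  · simpa [Int.dist_eq] using g2

/-- the per-box co-Lipschitz constant straight from the slab box of a letter sequence. [g100] -/
theorem isLayeredCrystal_of_slabBoxF {ℓ : ℤ → ℤ} {aLo aHi s τ hLo hHi lam mu c : ℝ} {L : E3 ≃L[ℝ] E3} {w : ℤ → E3}
    (hB : SlabBoxF ℓ aLo aHi s τ hLo hHi L w) (h012 : IsLetterSeq ℓ) (hc : 0 ≤ c) (hc2 : 2 * c ^ 2 ≤ lam ^ 2)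
    (haLo : 0 < aLo) (hs0 : 0 ≤ s) (hs1 : s < 1) (hτ : 0 ≤ τ) (hhLo : 0 ≤ hLo) (hhHi : 0 ≤ hHi)
    (hA : lam ^ 2 < (1 - s) ^ 2 * aLo ^ 2)
    (hAC : (1 - s) ^ 2 * τ ^ 2 * aLo ^ 4 ≤
      ((1 - s) ^ 2 * aLo ^ 2 - lam ^ 2) * ((τ ^ 2 + hLo ^ 2) * aLo ^ 2 - 2 / 3 * lam ^ 2))
    (hC2 : lam ^ 2 * (τ ^ 2 + 2 / 3 * (1 - s) ^ 2) ≤ hLo ^ 2 * (1 - s) ^ 2 * aLo ^ 2)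
    (hA' : (1 + s) ^ 2 * aHi ^ 2 < mu ^ 2)
    (hAC' : (1 + s) ^ 2 * τ ^ 2 * aHi ^ 4 ≤
      (mu ^ 2 - (1 + s) ^ 2 * aHi ^ 2) * (2 / 3 * mu ^ 2 - (τ ^ 2 + hHi ^ 2) * aHi ^ 2)) :
    IsLayeredCrystal c (gen₁ L) (gen₂ L) w :=
  isLayeredCrystal_of_idealLengthCmpF h012 hc hc2 (idealLengthCmpF_of_slabBoxF hB haLo hs0 hs1 hτ hhLo hhHi hA hAC hC2 hA' hAC')

/-- generator norms in the slab box of a letter sequence: `‖gen_i L‖ ≤ (1+s)·aHi` (only the chart part is used). [g100] -/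
theorem gen_norm_le_of_slabBoxF {ℓ : ℤ → ℤ} {aLo aHi s τ hLo hHi : ℝ} {L : E3 ≃L[ℝ] E3} {w : ℤ → E3}
    (hB : SlabBoxF ℓ aLo aHi s τ hLo hHi L w) (haLo : 0 ≤ aLo) (hs0 : 0 ≤ s) :
    ‖gen₁ L‖ ≤ (1 + s) * aHi ∧ ‖gen₂ L‖ ≤ (1 + s) * aHi := by
  obtain ⟨a, n, r, h, haLo', haHi', hconf, -⟩ := hB
  have ha : 0 ≤ a := haLo.trans haLo'
  have h₁ : ‖(triangularVec₁ (1 : ℝ) : E3)‖ = 1 := by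
    have := normSq_triangular_comb 1 0
    simp only [one_smul, zero_smul, add_zero] at this
    nlinarith [norm_nonneg (triangularVec₁ (1 : ℝ) : E3)]
  have h₂ : ‖(triangularVec₂ (1 : ℝ) : E3)‖ = 1 := by
    have := normSq_triangular_comb 0 1
    simp only [one_smul, zero_smul, zero_add] at this
    nlinarith [norm_nonneg (triangularVec₂ (1 : ℝ) : E3)]
  have hb₁ := (norm_map_bounds_of_isConfChart ha hconf (triangularVec₁ 1)).2
  have hb₂ := (norm_map_bounds_of_isConfChart ha hconf (triangularVec₂ 1)).2
  rw [h₁, mul_one] at hb₁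
  rw [h₂, mul_one] at hb₂
  have hs' : a + s * a ≤ (1 + s) * aHi := by nlinarith
  exact ⟨by simpa [gen₁] using hb₁.trans hs', by simpa [gen₂] using hb₂.trans hs'⟩

/-! ### §5 swap symmetries and the sign of the ideal `sin²` (Cauchy–Schwarz `d18² ≤ 4·n9·n9'`) -/

/-- Cauchy–Schwarz for the ideal form: `d18² ≤ 4·n9·n9'` (real coefficients; Lagrange's three-square identity). [g100] -/
theorem ideal_cs (A B m A' B' m' : ℝ) :
    (2 * A * A' + 2 * B * B' + A * B' + A' * B + 12 * m * m') ^ 2 ≤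
      4 * (A * A + A * B + B * B + 6 * m ^ 2) * (A' * A' + A' * B' + B' * B' + 6 * m' ^ 2) := by
  have h : 4 * (A * A + A * B + B * B + 6 * m ^ 2) * (A' * A' + A' * B' + B' * B' + 6 * m' ^ 2) -
      (2 * A * A' + 2 * B * B' + A * B' + A' * B + 12 * m * m') ^ 2 =
      3 * (A * B' - A' * B) ^ 2 + 6 * ((2 * A + B) * m' - (2 * A' + B') * m) ^ 2 + 18 * (B * m' - B' * m) ^ 2 := by ring
  nlinarith [h, sq_nonneg (A * B' - A' * B), sq_nonneg ((2 * A + B) * m' - (2 * A' + B') * m), sq_nonneg (B * m' - B' * m)]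

/-- swapping a pair negates its bond vector. [g100] -/
theorem bondVec_swap (a b : E3) (w : ℤ → E3) (x : (Cell 2 × ℤ) × (Cell 2 × ℤ)) :
    bondVec a b w (x.2, x.1) = -bondVec a b w x := by
  simp only [bondVec]; exact (neg_sub _ _).symm

/-- `sin²` is symmetric under swapping the first pair. [g100] -/
theorem sinSqPair_swap_left (a b : E3) (w : ℤ → E3) (x q : (Cell 2 × ℤ) × (Cell 2 × ℤ)) :
    sinSqPair a b w (x.2, x.1) q = sinSqPair a b w x q := by
  simp only [sinSqPair, bondVec_swap, inner_neg_left, norm_neg, neg_sq]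

/-- `sin²` is symmetric under swapping the second pair. [g100] -/
theorem sinSqPair_swap_right (a b : E3) (w : ℤ → E3) (x q : (Cell 2 × ℤ) × (Cell 2 × ℤ)) :
    sinSqPair a b w x (q.2, q.1) = sinSqPair a b w x q := by
  simp only [sinSqPair, bondVec_swap, inner_neg_right, norm_neg, neg_sq]

/-- `d18` changes sign under swapping the first pair. [g100] -/
theorem d18F_swap_left (ℓ : ℤ → ℤ) (x q : (Cell 2 × ℤ) × (Cell 2 × ℤ)) : d18F ℓ (x.2, x.1) q = -d18F ℓ x q := by
  simp only [d18F]; ring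

/-- `d18` changes sign under swapping the second pair. [g100] -/
theorem d18F_swap_right (ℓ : ℤ → ℤ) (x q : (Cell 2 × ℤ) × (Cell 2 × ℤ)) : d18F ℓ x (q.2, q.1) = -d18F ℓ x q := by
  simp only [d18F]; ring

/-- ideal `sin²` is symmetric under swapping the first pair. [g100] -/
theorem sinSq0F_swap_left (ℓ : ℤ → ℤ) (x q : (Cell 2 × ℤ) × (Cell 2 × ℤ)) : sinSq0F ℓ (x.2, x.1) q = sinSq0F ℓ x q := by
  simp only [sinSq0F, d18F_swap_left, n9F_swap, Int.cast_neg, neg_sq]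

/-- ideal `sin²` is symmetric under swapping the second pair. [g100] -/
theorem sinSq0F_swap_right (ℓ : ℤ → ℤ) (x q : (Cell 2 × ℤ) × (Cell 2 × ℤ)) : sinSq0F ℓ x (q.2, q.1) = sinSq0F ℓ x q := by
  simp only [sinSq0F, d18F_swap_right, n9F_swap, Int.cast_neg, neg_sq]

/-- ideal `sin² ≥ 0` on pairs of nonzero ideal length (Cauchy–Schwarz `d18² ≤ 4·n9·n9'`). [g100] -/
theorem sinSq0F_nonneg (ℓ : ℤ → ℤ) (x q : (Cell 2 × ℤ) × (Cell 2 × ℤ)) (hx : 0 < n9F ℓ x) (hq : 0 < n9F ℓ q) :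
    0 ≤ sinSq0F ℓ x q := by
  have hxℝ : (0 : ℝ) < n9F ℓ x := by exact_mod_cast hx
  have hqℝ : (0 : ℝ) < n9F ℓ q := by exact_mod_cast hq
  have hcs : (d18F ℓ x q : ℝ) ^ 2 ≤ 4 * (n9F ℓ x : ℝ) * n9F ℓ q := by
    have h := ideal_cs ((refF0 ℓ x.2 - refF0 ℓ x.1 : ℤ) : ℝ) ((refF1 ℓ x.2 - refF1 ℓ x.1 : ℤ) : ℝ)
      ((x.2.2 - x.1.2 : ℤ) : ℝ) ((refF0 ℓ q.2 - refF0 ℓ q.1 : ℤ) : ℝ) ((refF1 ℓ q.2 - refF1 ℓ q.1 : ℤ) : ℝ)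
      ((q.2.2 - q.1.2 : ℤ) : ℝ)
    have e1 : (d18F ℓ x q : ℝ) = 2 * ((refF0 ℓ x.2 - refF0 ℓ x.1 : ℤ) : ℝ) * ((refF0 ℓ q.2 - refF0 ℓ q.1 : ℤ) : ℝ) +
        2 * ((refF1 ℓ x.2 - refF1 ℓ x.1 : ℤ) : ℝ) * ((refF1 ℓ q.2 - refF1 ℓ q.1 : ℤ) : ℝ) +
        ((refF0 ℓ x.2 - refF0 ℓ x.1 : ℤ) : ℝ) * ((refF1 ℓ q.2 - refF1 ℓ q.1 : ℤ) : ℝ) +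
        ((refF0 ℓ q.2 - refF0 ℓ q.1 : ℤ) : ℝ) * ((refF1 ℓ x.2 - refF1 ℓ x.1 : ℤ) : ℝ) +
        12 * ((x.2.2 - x.1.2 : ℤ) : ℝ) * ((q.2.2 - q.1.2 : ℤ) : ℝ) := by
      simp only [d18F]; push_cast; ring
    have e2 : ∀ y : (Cell 2 × ℤ) × (Cell 2 × ℤ), (n9F ℓ y : ℝ) =
        ((refF0 ℓ y.2 - refF0 ℓ y.1 : ℤ) : ℝ) * ((refF0 ℓ y.2 - refF0 ℓ y.1 : ℤ) : ℝ) +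
        ((refF0 ℓ y.2 - refF0 ℓ y.1 : ℤ) : ℝ) * ((refF1 ℓ y.2 - refF1 ℓ y.1 : ℤ) : ℝ) +
        ((refF1 ℓ y.2 - refF1 ℓ y.1 : ℤ) : ℝ) * ((refF1 ℓ y.2 - refF1 ℓ y.1 : ℤ) : ℝ) +
        6 * ((y.2.2 - y.1.2 : ℤ) : ℝ) ^ 2 := by
      intro y; simp only [n9F]; push_cast; ring
    rw [e1, e2 x, e2 q]; exact h
  simp only [sinSq0F]
  rw [sub_nonneg, div_le_one (by positivity)]
  exact hcs

end Summit.AtomisticToContinuum.Crystallization.Theorems.ChartedZeroExcessLayeredLatticeLiouville
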